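import Mathlib
import HarnessLib
import Summits.Ventures.LatticeQCDFlow.Scaling.PerfectRelaxationTelescoping

/-!
# LatticeQCDFlow / Scaling — the annealing-cost SANDWICH and the explicit layer count (v2.5)

HONEST FRAMING: exact (Metropolis-corrected) sampling algorithms for lattice gauge theory; figures
of merit are autocorrelation/cost numbers at stated couplings and volumes; no continuum-physics
claim.

Venture `LatticeQCDFlow` (cell pub-lqcd), topic `Scaling`, FANOUT row 29 (theory2) — OUR WORK
(THEORY-2.md v2.5 §3.5 (viii) / §4 row C3).  Finite-state, elementary; nothing is cited as a fact.
Imports `PerfectRelaxationTelescoping` (item 30).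

* `meanObs_antitone` — `β ↦ ⟨A⟩_β` is antitone (the two secant bounds of item 30).
* `negLog_prod_essFrac_unif_ge` / `_sandwich` — along `β_k = β₀ + kΔ/n` with perfect relaxation,
  **`(Δ/n)·(⟨A⟩_{β₀+Δ/n} − ⟨A⟩_{β₀+Δ}) ≤ −log Π_k ESS_k ≤ (Δ/n)·(⟨A⟩_{β₀} − ⟨A⟩_{β₀+Δ+Δ/n})`**:
  both sides are `(Δ/n) × (a drop of the mean action over a window of width Δ)`, so the cost of
  perfectly relaxed uniform annealing IS `Θ((Δ/n)·(⟨A⟩_start − ⟨A⟩_end))` up to the one-step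
  shifts of the window; and `0 ≤ −log Π_k ESS_k` for `Δ ≥ 0`.
* `negLog_ess_sites_sandwich` — the same with the factor `m` for `m` independent sites.
* `ess_sites_ge_of_layers` — THE EXPLICIT LAYER COUNT: for `a ≤ A ≤ b`, `Δ ≥ 0`, `0 < ε < 1`,
  **`n ≥ m·Δ·(b − a)/log(1/ε)` layers give `ÊSS ≥ ε`** (perfect relaxation, uniform protocol).
-/

noncomputable section

namespace Summit.Ventures.LatticeQCDFlow.Theory2

open Finset Summit.Ventures.LatticeQCDFlow.Exactness

variable {X : Type*} [Fintype X] [Nonempty X]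

/-- **`β ↦ ⟨A⟩_β` is antitone** (`F` convex: lower secant at `β` ≤ upper secant at `β'`).
[folklore] -/
theorem meanObs_antitone (A : X → ℝ) : Antitone (meanObs A) := by
  intro β β' hββ'
  rcases eq_or_lt_of_le hββ' with h | h
  · rw [h]
  have h1 := logPartFn_sub_ge A β (β' - β)
  have h2 := logPartFn_sub_le A β (β' - β)
  rw [show β + (β' - β) = β' by ring] at h1 h2
  have hpos : 0 < β' - β := sub_pos.2 h
  nlinarith

/-- Lower telescoping bound: `(Δ/n)·(⟨A⟩_{β₀+Δ/n} − ⟨A⟩_{β₀+Δ}) ≤ −log Π_k ESS_k`. [folklore] -/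
theorem negLog_prod_essFrac_unif_ge (A : X → ℝ) (β₀ Δ : ℝ) {n : ℕ} (hn : 0 < n) :
    Δ / n * (meanObs A (β₀ + Δ / n) - meanObs A (β₀ + Δ)) ≤
      -Real.log (∏ k : Fin n, essFrac (gibbsLaw fun x => unifProtocol β₀ Δ n k.succ * A x)
        (gibbsLaw fun x => unifProtocol β₀ Δ n k.castSucc * A x)) := by
  rw [negLog_prod_essFrac_unif A β₀ Δ hn]
  have h1 := logPartFn_sub_ge A (β₀ + Δ) (Δ / n)
  have h2 := logPartFn_sub_le A β₀ (Δ / n)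
  linarith

/-- **`0 ≤ −log Π_k ESS_k`** along the uniform protocol with `Δ ≥ 0` (from the lower bound and
`meanObs_antitone`; of course also from `ESS ≤ 1`). [folklore] -/
theorem negLog_prod_essFrac_unif_nonneg (A : X → ℝ) (β₀ : ℝ) {Δ : ℝ} (hΔ : 0 ≤ Δ) {n : ℕ}
    (hn : 0 < n) :
    0 ≤ -Real.log (∏ k : Fin n, essFrac (gibbsLaw fun x => unifProtocol β₀ Δ n k.succ * A x)
        (gibbsLaw fun x => unifProtocol β₀ Δ n k.castSucc * A x)) := by
  refine le_trans ?_ (negLog_prod_essFrac_unif_ge A β₀ Δ hn)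
  have hn' : (1 : ℝ) ≤ n := by exact_mod_cast hn
  have hn0 : (0 : ℝ) < n := by linarith
  have hstep : Δ / n ≤ Δ := by
    rw [div_le_iff₀ hn0]
    nlinarith
  have hmono := meanObs_antitone A (show β₀ + Δ / n ≤ β₀ + Δ by linarith)
  exact mul_nonneg (div_nonneg hΔ hn0.le) (by linarith)

/-! ## `m` independent sites -/

section Sites

variable {Z : Type*} [LinearOrder Z] [Fintype Z] [Nonempty Z] {m n : ℕ}

/-- **THE ANNEALING-COST SANDWICH on `m` sites** (perfect relaxation, uniform protocol):
`(mΔ/n)(⟨A⟩_{β₀+Δ/n} − ⟨A⟩_{β₀+Δ}) ≤ −log ÊSS ≤ (mΔ/n)(⟨A⟩_{β₀} − ⟨A⟩_{β₀+Δ+Δ/n})`. [folklore] -/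
theorem negLog_ess_sites_sandwich (m : ℕ) (A : Z → ℝ) (β₀ Δ : ℝ) (hn : 0 < n) :
    (m : ℝ) * (Δ / n * (meanObs A (β₀ + Δ / n) - meanObs A (β₀ + Δ))) ≤
        -Real.log (essFrac
          (revPathLaw (siteSum m A (unifProtocol β₀ Δ n)) fun k _ ψ =>
            gibbsLaw (siteSum m A (unifProtocol β₀ Δ n) k.succ) ψ)
          (pathLaw (gibbsLaw (siteSum m A (unifProtocol β₀ Δ n) 0)) fun k _ ψ =>
            gibbsLaw (siteSum m A (unifProtocol β₀ Δ n) k.succ) ψ)) ∧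
      -Real.log (essFrac
          (revPathLaw (siteSum m A (unifProtocol β₀ Δ n)) fun k _ ψ =>
            gibbsLaw (siteSum m A (unifProtocol β₀ Δ n) k.succ) ψ)
          (pathLaw (gibbsLaw (siteSum m A (unifProtocol β₀ Δ n) 0)) fun k _ ψ =>
            gibbsLaw (siteSum m A (unifProtocol β₀ Δ n) k.succ) ψ)) ≤
        (m : ℝ) * (Δ / n * (meanObs A β₀ - meanObs A (β₀ + Δ + Δ / n))) := by
  rw [ess_perfect_relaxation_sites, Real.log_pow]
  have hm : (0 : ℝ) ≤ m := Nat.cast_nonneg _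
  have hlo := mul_le_mul_of_nonneg_left (negLog_prod_essFrac_unif_ge A β₀ Δ hn) hm
  have hhi := mul_le_mul_of_nonneg_left (negLog_prod_essFrac_unif_le A β₀ Δ hn) hm
  constructor
  · rw [neg_mul_eq_mul_neg]
    exact hlo
  · rw [neg_mul_eq_mul_neg]
    exact hhi

/-- **THE EXPLICIT LAYER COUNT.**  `m` independent sites, `a ≤ A ≤ b`, `Δ ≥ 0`, perfect
relaxation along the uniform protocol, target `0 < ε < 1`: if
`n ≥ m·Δ·(b − a)/log(1/ε)` then `ÊSS ≥ ε`.  [folklore] -/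
theorem ess_sites_ge_of_layers (m : ℕ) (A : Z → ℝ) {a b : ℝ} (hA : ∀ z, a ≤ A z ∧ A z ≤ b)
    (β₀ : ℝ) {Δ : ℝ} (hΔ : 0 ≤ Δ) {ε : ℝ} (hε0 : 0 < ε) (hε1 : ε < 1) (hn : 0 < n)
    (hlayers : (m : ℝ) * Δ * (b - a) / Real.log (1 / ε) ≤ n) :
    ε ≤ essFrac
        (revPathLaw (siteSum m A (unifProtocol β₀ Δ n)) fun k _ ψ =>
          gibbsLaw (siteSum m A (unifProtocol β₀ Δ n) k.succ) ψ)
        (pathLaw (gibbsLaw (siteSum m A (unifProtocol β₀ Δ n) 0)) fun k _ ψ =>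
          gibbsLaw (siteSum m A (unifProtocol β₀ Δ n) k.succ) ψ) := by
  refine le_trans ?_ (perfectRelaxation_sites_ge_linear m A hA β₀ hΔ hn)
  have hL : 0 < Real.log (1 / ε) := Real.log_pos (by rw [lt_div_iff₀ hε0]; linarith)
  have hn' : (0 : ℝ) < n := by exact_mod_cast hn
  -- `m Δ (b−a) ≤ n · log(1/ε)` hence `m Δ (b−a)/n ≤ log(1/ε)`
  have h1 : (m : ℝ) * Δ * (b - a) ≤ n * Real.log (1 / ε) := by
    rwa [div_le_iff₀ hL] at hlayers
  have h2 : (m : ℝ) * (Δ * (b - a) / n) ≤ Real.log (1 / ε) := by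
    rw [← mul_div_assoc, div_le_iff₀ hn', ← mul_assoc]
    linarith
  calc ε = Real.exp (-Real.log (1 / ε)) := by
        rw [Real.log_div one_ne_zero hε0.ne', Real.log_one, zero_sub, neg_neg, Real.exp_log hε0]
    _ ≤ Real.exp (-((m : ℝ) * (Δ * (b - a) / n))) := Real.exp_le_exp.2 (by linarith)

end Sites

end Summit.Ventures.LatticeQCDFlow.Theory2

end
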